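import Mathlib
import Summits.ValiantsHypothesis.ValiantsHypothesis.Theorems.NewtonUnitEquationsDissociatedUniformTotalsLawUnimodal
import HarnessLib

/-!
# Crux `NewtonUnitEquations.DissociatedUniform` (stmt-ValiantsHypothesis-5905): CHAIN LOCALISATION of the tops of a fibre union

Companion of `…TotalsLawUnimodal` (`CycUnimodalAt`, the walk, `mem_fibre_or_top_of_isStrictTop`: a strict top of
`U_s(Z) = ⋃_{z∈Z} P_{s-z}` in a direction `w` along which both label sequences `α = ⟨w, a·⟩`, `β = ⟨w, b·⟩` are cyclically
unimodal lies in a BOUNDARY fibre or is the mode pair).  This file sharpens the localisation from "which fibre" to "which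
pair": with modes `m_α = n_α + d_α`, `m_β = n_β + d_β`, `m = m_α + m_β`, and the FORWARD GAP `g` = least `n ≥ 0` with the fibre
`m + n` present (position `s - (m + n) ∈ Z`) and BACKWARD GAP `g'` (least `n` with `m - n` present),

* **`exists_chain_of_isStrictTop`**: a strict `w`-top of `U_s(Z)` is `a(m_α + i) + b(m_β + j)` with `i, j ≥ 0`, `i + j = g`
  (a pair of the FORWARD CHAIN: both letters on the descending arcs of their sequences, at total distance `g` from the modes),
  or `a(m_α - i) + b(m_β - j)` with `i + j = g'` (BACKWARD CHAIN).  No general position, no injectivity: the proof is a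
  rectangle-domination argument (every pair `(m_α + i', m_β + j')` with `i' ≤ i`, `j' ≤ j` has a value at least that of
  `(m_α + i, m_β + j)`, and these pairs fill all fibres `m, …, m + i + j`).
* Tools: `CycUnimodalAt.desc_le` / `asc_le` (monotonicity along the two arcs), `exists_nat_pos` (every fibre is `m + n`).

This is the static form of the "top pair = mode pair + offsets inside the gap" structure behind the census of memo
`Cruxes/DissociatedUniform/NOTES-t1g6.md` §3 (candidate count `4q - 2|W|` for co-oriented pairs, attained); the counting
consequences are in the companion `…TotalsLawChainCount`.
Honest label: a structural lemma on the convexly ordered stratum; `ConvexUnionVertBound C` (`C ≥ 3`), `UnionTotalsLaw`,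
`TotalsLawThree` remain OPEN; nothing here bears on VP ≠ VNP.
[folklore: the maximum of a unimodal sequence over a set of indices is attained next to the mode]
-/

set_option linter.dupNamespace false -- `ValiantsHypothesis.ValiantsHypothesis` (summit = problem) in every name

open scoped BigOperators Pointwise

namespace Summit.ValiantsHypothesis.ValiantsHypothesis.Theorems.NewtonUnitEquationsDissociatedUniform

namespace TotalsLaw

open Literature.Computability.AlgebraicComplexity.KPTT.PlanarMinkowski

section Chains

variable {q : ℕ} [NeZero q]

omit [NeZero q] in
/-- **Monotonicity along the descending arc**: for `d ≤ k ≤ k' < q`, `f (n + k') ≤ f (n + k)`. [folklore] -/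
theorem CycUnimodalAt.desc_le {f : ZMod q → ℝ} {n : ZMod q} {d : ℕ} (h : CycUnimodalAt f n d) {k k' : ℕ}
    (hdk : d ≤ k) (hkk' : k ≤ k') (hk' : k' < q) : f (n + (k' : ZMod q)) ≤ f (n + (k : ZMod q)) := by
  obtain ⟨-, -, hdesc⟩ := h
  induction k' with
  | zero =>
    have hk0 : k = 0 := Nat.le_zero.1 hkk'
    subst hk0
    exact le_rfl
  | succ k' ih =>
    rcases Nat.lt_or_ge k (k' + 1) with hlt | hge
    · exact (hdesc k' (by omega) hk').trans (ih (by omega) (by omega))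
    · rw [le_antisymm hkk' hge]

omit [NeZero q] in
/-- **Monotonicity along the ascending arc**: for `k ≤ k' ≤ d` (`d < q`), `f (n + k) ≤ f (n + k')`. [folklore] -/
theorem CycUnimodalAt.asc_le {f : ZMod q → ℝ} {n : ZMod q} {d : ℕ} (h : CycUnimodalAt f n d) {k k' : ℕ}
    (hkk' : k ≤ k') (hk'd : k' ≤ d) : f (n + (k : ZMod q)) ≤ f (n + (k' : ZMod q)) := by
  obtain ⟨-, hasc, -⟩ := h
  induction k' with
  | zero =>
    have hk0 : k = 0 := Nat.le_zero.1 hkk'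
    subst hk0
    exact le_rfl
  | succ k' ih =>
    rcases Nat.lt_or_ge k (k' + 1) with hlt | hge
    · exact (ih (by omega) (by omega)).trans (hasc k' (by omega))
    · rw [le_antisymm hkk' hge]

omit [NeZero q] in
/-- A letter within `i` steps AFTER the mode on the descending arc is dominated by every letter between the mode and itself:
`f (m + i) ≤ f (m + i')` for `i' ≤ i` (`m = n + d`, `d + i < q`). [folklore] -/
theorem CycUnimodalAt.le_of_desc {f : ZMod q → ℝ} {n : ZMod q} {d : ℕ} (h : CycUnimodalAt f n d) {i i' : ℕ}
    (hi' : i' ≤ i) (hi : d + i < q) :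
    f (n + (d : ZMod q) + (i : ZMod q)) ≤ f (n + (d : ZMod q) + (i' : ZMod q)) := by
  have e1 : n + (d : ZMod q) + (i : ZMod q) = n + ((d + i : ℕ) : ZMod q) := by push_cast; ring
  have e2 : n + (d : ZMod q) + (i' : ZMod q) = n + ((d + i' : ℕ) : ZMod q) := by push_cast; ring
  rw [e1, e2]
  exact h.desc_le (by omega) (by omega) hi

omit [NeZero q] in
/-- A letter within `i` steps BEFORE the mode on the ascending arc is dominated by every letter between itself and the mode:
`f (m - i) ≤ f (m - i')` for `i' ≤ i ≤ d`. [folklore] -/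
theorem CycUnimodalAt.le_of_asc {f : ZMod q → ℝ} {n : ZMod q} {d : ℕ} (h : CycUnimodalAt f n d) {i i' : ℕ}
    (hi' : i' ≤ i) (hi : i ≤ d) :
    f (n + (d : ZMod q) - (i : ZMod q)) ≤ f (n + (d : ZMod q) - (i' : ZMod q)) := by
  have e1 : n + (d : ZMod q) - (i : ZMod q) = n + ((d - i : ℕ) : ZMod q) := by
    rw [Nat.cast_sub hi]; ring
  have e2 : n + (d : ZMod q) - (i' : ZMod q) = n + ((d - i' : ℕ) : ZMod q) := by
    rw [Nat.cast_sub (hi'.trans hi)]; ring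
  rw [e1, e2]
  exact h.asc_le (by omega) (by omega)

/-- Every label is the mode shifted FORWARD by its descending offset or BACKWARD by its ascending offset: `x = m + i` with
`d + i < q`, or `x = m - i` with `i ≤ d` (`m = n + d`). [folklore] -/
theorem exists_offset (n : ZMod q) (d : ℕ) (x : ZMod q) :
    (∃ i : ℕ, d + i < q ∧ x = n + (d : ZMod q) + (i : ZMod q)) ∨ (∃ i : ℕ, i ≤ d ∧ x = n + (d : ZMod q) - (i : ZMod q)) := by
  set k := (x - n).val with hk
  have hkq : k < q := ZMod.val_lt _
  have hx : x = n + (k : ZMod q) := eq_add_val n x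
  rcases Nat.lt_or_ge k d with hlt | hge
  · right
    refine ⟨d - k, by omega, ?_⟩
    rw [hx, Nat.cast_sub hlt.le]; ring
  · left
    refine ⟨k - d, by omega, ?_⟩
    rw [hx, Nat.cast_sub hge]; ring

/-- Every residue is a natural shift of any base point: `r = m + n` for some `n < q`. [folklore] -/
theorem exists_nat_shift (m r : ZMod q) : ∃ n : ℕ, n < q ∧ r = m + (n : ZMod q) :=
  ⟨(r - m).val, ZMod.val_lt _, eq_add_val m r⟩

/-- … and a natural BACKWARD shift: `r = m - n` for some `n < q`. [folklore] -/
theorem exists_nat_shift_neg (m r : ZMod q) : ∃ n : ℕ, n < q ∧ r = m - (n : ZMod q) := by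
  obtain ⟨n, hn, h⟩ := exists_nat_shift (-m) (-r)
  exact ⟨n, hn, by rw [show r = -(-r) from (neg_neg r).symm, h]; ring⟩

variable (a b : ZMod q → (Fin 2 → ℝ))

/-- A pair whose fibre is present gives a point of the Finset model of the union. [folklore] -/
theorem add_mem_unionFin (Z : Finset (ZMod q)) {s x y : ZMod q} (h : s - x - y ∈ Z) :
    a x + b y ∈ unionFin a b (Z : Set (ZMod q)) s := by
  rw [← Finset.mem_coe, coe_unionFin]
  exact mem_unionPts.2 ⟨x, y, h, rfl⟩

/-- A dominating present pair IS the strict top. [folklore] -/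
theorem eq_of_dominates {w : Fin 2 → ℝ} (Z : Finset (ZMod q)) {s x y : ZMod q} {p : Fin 2 → ℝ}
    (htop : IsStrictTop w (unionFin a b (Z : Set (ZMod q)) s) p) (hmem : s - x - y ∈ Z)
    (hval : w ⬝ᵥ p ≤ w ⬝ᵥ (a x + b y)) : p = a x + b y := by
  by_contra hne
  have := htop.lt (add_mem_unionFin a b Z hmem) (Ne.symm hne)
  linarith

/-- **Chain localisation.**  Let `α = ⟨w, a·⟩`, `β = ⟨w, b·⟩` be cyclically unimodal with modes `m_α = n_α + d_α`,
`m_β = n_β + d_β`, `m = m_α + m_β`.  A strict `w`-top `p` of `U_s(Z)` is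
* a FORWARD CHAIN point: `p = a(m_α + i) + b(m_β + j)` with the fibre `m + (i + j)` present and all fibres `m + n`, `n < i + j`,
  absent (so `i + j` is the forward gap from `m` to the present fibres), or
* a BACKWARD CHAIN point: `p = a(m_α - i) + b(m_β - j)` with `m - (i + j)` present and all `m - n`, `n < i + j`, absent.
[folklore] -/
theorem exists_chain_of_isStrictTop {w : Fin 2 → ℝ} {nα nβ : ZMod q} {dα dβ : ℕ}
    (hα : CycUnimodalAt (fun x => w ⬝ᵥ a x) nα dα) (hβ : CycUnimodalAt (fun y => w ⬝ᵥ b y) nβ dβ)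
    (Z : Finset (ZMod q)) (s : ZMod q) {p : Fin 2 → ℝ} (htop : IsStrictTop w (unionFin a b (Z : Set (ZMod q)) s) p) :
    (∃ i j : ℕ, p = a (nα + (dα : ZMod q) + (i : ZMod q)) + b (nβ + (dβ : ZMod q) + (j : ZMod q)) ∧
        s - (nα + (dα : ZMod q) + (nβ + (dβ : ZMod q)) + ((i + j : ℕ) : ZMod q)) ∈ Z ∧
        ∀ n : ℕ, n < i + j → s - (nα + (dα : ZMod q) + (nβ + (dβ : ZMod q)) + (n : ZMod q)) ∉ Z) ∨
      (∃ i j : ℕ, p = a (nα + (dα : ZMod q) - (i : ZMod q)) + b (nβ + (dβ : ZMod q) - (j : ZMod q)) ∧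
        s - (nα + (dα : ZMod q) + (nβ + (dβ : ZMod q)) - ((i + j : ℕ) : ZMod q)) ∈ Z ∧
        ∀ n : ℕ, n < i + j → s - (nα + (dα : ZMod q) + (nβ + (dβ : ZMod q)) - (n : ZMod q)) ∉ Z) := by
  classical
  set mα : ZMod q := nα + (dα : ZMod q) with hmα
  set mβ : ZMod q := nβ + (dβ : ZMod q) with hmβ
  set m : ZMod q := mα + mβ with hm
  -- a representing pair
  have hpU : p ∈ unionPts a b (Z : Set (ZMod q)) s := by
    rw [← coe_unionFin a b (Z : Set (ZMod q)) s]; exact htop.mem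
  obtain ⟨x₀, y₀, hz₀, hp₀⟩ := mem_unionPts.1 hpU
  have hz₀' : s - x₀ - y₀ ∈ Z := hz₀
  -- the two gaps (as `Nat.find`)
  have hexF : ∃ n : ℕ, s - (m + (n : ZMod q)) ∈ Z := by
    obtain ⟨n, -, hn⟩ := exists_nat_shift m (x₀ + y₀)
    exact ⟨n, by rw [← hn, show s - (x₀ + y₀) = s - x₀ - y₀ by ring]; exact hz₀'⟩
  have hexB : ∃ n : ℕ, s - (m - (n : ZMod q)) ∈ Z := by
    obtain ⟨n, -, hn⟩ := exists_nat_shift_neg m (x₀ + y₀)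
    exact ⟨n, by rw [← hn, show s - (x₀ + y₀) = s - x₀ - y₀ by ring]; exact hz₀'⟩
  set g := Nat.find hexF with hg
  set g' := Nat.find hexB with hg'
  have hgZ : s - (m + (g : ZMod q)) ∈ Z := Nat.find_spec hexF
  have hg'Z : s - (m - (g' : ZMod q)) ∈ Z := Nat.find_spec hexB
  have hgmin : ∀ n : ℕ, n < g → s - (m + (n : ZMod q)) ∉ Z := fun n hn => Nat.find_min hexF hn
  have hg'min : ∀ n : ℕ, n < g' → s - (m - (n : ZMod q)) ∉ Z := fun n hn => Nat.find_min hexB hn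
  -- the value of `p`
  have hval₀ : w ⬝ᵥ p = w ⬝ᵥ a x₀ + w ⬝ᵥ b y₀ := by rw [hp₀, dotProduct_add]
  have hmaxα : ∀ x, w ⬝ᵥ a x ≤ w ⬝ᵥ a mα := fun x => hα.le_mode x
  have hmaxβ : ∀ y, w ⬝ᵥ b y ≤ w ⬝ᵥ b mβ := fun y => hβ.le_mode y
  -- conclusions packaged
  have concF : ∀ i j : ℕ, i + j = g → p = a (mα + (i : ZMod q)) + b (mβ + (j : ZMod q)) →
      (∃ i j : ℕ, p = a (nα + (dα : ZMod q) + (i : ZMod q)) + b (nβ + (dβ : ZMod q) + (j : ZMod q)) ∧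
        s - (nα + (dα : ZMod q) + (nβ + (dβ : ZMod q)) + ((i + j : ℕ) : ZMod q)) ∈ Z ∧
        ∀ n : ℕ, n < i + j → s - (nα + (dα : ZMod q) + (nβ + (dβ : ZMod q)) + (n : ZMod q)) ∉ Z) := by
    intro i j hij hp
    exact ⟨i, j, hp, by rw [hij]; exact hgZ, by rw [hij]; exact hgmin⟩
  have concB : ∀ i j : ℕ, i + j = g' → p = a (mα - (i : ZMod q)) + b (mβ - (j : ZMod q)) →
      (∃ i j : ℕ, p = a (nα + (dα : ZMod q) - (i : ZMod q)) + b (nβ + (dβ : ZMod q) - (j : ZMod q)) ∧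
        s - (nα + (dα : ZMod q) + (nβ + (dβ : ZMod q)) - ((i + j : ℕ) : ZMod q)) ∈ Z ∧
        ∀ n : ℕ, n < i + j → s - (nα + (dα : ZMod q) + (nβ + (dβ : ZMod q)) - (n : ZMod q)) ∉ Z) := by
    intro i j hij hp
    exact ⟨i, j, hp, by rw [hij]; exact hg'Z, by rw [hij]; exact hg'min⟩
  -- position bookkeeping: the fibre of `(mα ± i, mβ ± j)`
  have posF : ∀ i j : ℕ, s - (mα + (i : ZMod q)) - (mβ + (j : ZMod q)) = s - (m + ((i + j : ℕ) : ZMod q)) := by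
    intro i j; push_cast; ring
  have posB : ∀ i j : ℕ, s - (mα - (i : ZMod q)) - (mβ - (j : ZMod q)) = s - (m - ((i + j : ℕ) : ZMod q)) := by
    intro i j; push_cast; ring
  have posFB : ∀ i j : ℕ, j ≤ i → s - (mα + (i : ZMod q)) - (mβ - (j : ZMod q)) = s - (m + ((i - j : ℕ) : ZMod q)) := by
    intro i j hji; rw [Nat.cast_sub hji]; ring
  have posFB' : ∀ i j : ℕ, i ≤ j → s - (mα + (i : ZMod q)) - (mβ - (j : ZMod q)) = s - (m - ((j - i : ℕ) : ZMod q)) := by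
    intro i j hij; rw [Nat.cast_sub hij]; ring
  have posBF : ∀ i j : ℕ, i ≤ j → s - (mα - (i : ZMod q)) - (mβ + (j : ZMod q)) = s - (m + ((j - i : ℕ) : ZMod q)) := by
    intro i j hij; rw [Nat.cast_sub hij]; ring
  have posBF' : ∀ i j : ℕ, j ≤ i → s - (mα - (i : ZMod q)) - (mβ + (j : ZMod q)) = s - (m - ((i - j : ℕ) : ZMod q)) := by
    intro i j hji; rw [Nat.cast_sub hji]; ring
  rcases exists_offset nα dα x₀ with ⟨i₀, hi₀q, hx₀⟩ | ⟨i₀, hi₀d, hx₀⟩ <;>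
    rcases exists_offset nβ dβ y₀ with ⟨j₀, hj₀q, hy₀⟩ | ⟨j₀, hj₀d, hy₀⟩
  · -- DD: both letters on descending arcs; the forward chain
    have hgle : g ≤ i₀ + j₀ := Nat.find_min' hexF (by rw [← posF, ← hx₀, ← hy₀]; exact hz₀')
    set i := min i₀ g with hi
    have hij : i + (g - i) = g := by omega
    refine Or.inl (concF i (g - i) hij (eq_of_dominates a b Z htop (by rw [posF, hij]; exact hgZ) ?_))
    rw [hval₀, dotProduct_add, hx₀, hy₀]
    exact add_le_add (hα.le_of_desc (by omega) hi₀q) (hβ.le_of_desc (by omega) hj₀q)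
  · -- DA: `x₀` descending (offset `i₀`), `y₀` ascending (offset `j₀`)
    by_cases hgi : g ≤ i₀
    · refine Or.inl (concF g 0 (by omega) (eq_of_dominates a b Z htop (by rw [posF]; exact hgZ) ?_))
      rw [hval₀, dotProduct_add, hx₀, hy₀, Nat.cast_zero, add_zero]
      exact add_le_add (hα.le_of_desc hgi hi₀q) (hmaxβ _)
    by_cases hgj : g' ≤ j₀
    · refine Or.inr (concB 0 g' (by omega) (eq_of_dominates a b Z htop (by rw [posB, Nat.zero_add]; exact hg'Z) ?_))
      rw [hval₀, dotProduct_add, hx₀, hy₀, Nat.cast_zero, sub_zero]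
      exact add_le_add (hmaxα _) (hβ.le_of_asc hgj hj₀d)
    exfalso
    push Not at hgi hgj
    rcases le_total j₀ i₀ with hji | hij
    · exact hgmin (i₀ - j₀) (by omega) (by rw [← posFB i₀ j₀ hji, ← hx₀, ← hy₀]; exact hz₀')
    · exact hg'min (j₀ - i₀) (by omega) (by rw [← posFB' i₀ j₀ hij, ← hx₀, ← hy₀]; exact hz₀')
  · -- AD: `x₀` ascending (offset `i₀`), `y₀` descending (offset `j₀`)
    by_cases hgj : g ≤ j₀
    · refine Or.inl (concF 0 g (by omega) (eq_of_dominates a b Z htop (by rw [posF, Nat.zero_add]; exact hgZ) ?_))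
      rw [hval₀, dotProduct_add, hx₀, hy₀, Nat.cast_zero, add_zero]
      exact add_le_add (hmaxα _) (hβ.le_of_desc hgj hj₀q)
    by_cases hgi : g' ≤ i₀
    · refine Or.inr (concB g' 0 (by omega) (eq_of_dominates a b Z htop (by rw [posB]; exact hg'Z) ?_))
      rw [hval₀, dotProduct_add, hx₀, hy₀, Nat.cast_zero, sub_zero]
      exact add_le_add (hα.le_of_asc hgi hi₀d) (hmaxβ _)
    exfalso
    push Not at hgi hgj
    rcases le_total i₀ j₀ with hij | hji
    · exact hgmin (j₀ - i₀) (by omega) (by rw [← posBF i₀ j₀ hij, ← hx₀, ← hy₀]; exact hz₀')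
    · exact hg'min (i₀ - j₀) (by omega) (by rw [← posBF' i₀ j₀ hji, ← hx₀, ← hy₀]; exact hz₀')
  · -- AA: both ascending; the backward chain
    have hgle : g' ≤ i₀ + j₀ := Nat.find_min' hexB (by rw [← posB, ← hx₀, ← hy₀]; exact hz₀')
    set i := min i₀ g' with hi
    have hij : i + (g' - i) = g' := by omega
    refine Or.inr (concB i (g' - i) hij (eq_of_dominates a b Z htop (by rw [posB, hij]; exact hg'Z) ?_))
    rw [hval₀, dotProduct_add, hx₀, hy₀]
    exact add_le_add (hα.le_of_asc (by omega) hi₀d) (hβ.le_of_asc (by omega) hj₀d)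

end Chains

end TotalsLaw

end Summit.ValiantsHypothesis.ValiantsHypothesis.Theorems.NewtonUnitEquationsDissociatedUniform
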